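import Literature.Probability.RandomPlanarGeometry.HexSAWSurfaceFourthOrderLower
import Literature.Probability.RandomPlanarGeometry.HexSAWSurfaceFourthOrderUpper
import Literature.Probability.RandomPlanarGeometry.HexSAWSurfaceWallDensity
import Mathlib.Analysis.SpecialFunctions.Log.Deriv
import Mathlib.Analysis.Complex.ExponentialBounds
import HarnessLib

/-!
# BBdGDCG surface bridges: the SECOND TERM of the contact-density deficit —
# `e^{3t} (1/2 − ρ^±(t) − e^{−2t}) → 3/2`, i.e. `ρ^±(y) = 1/2 − y⁻² − (3/2) y⁻³ + O(y^{−7/2})`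

Topic `Literature/Probability/RandomPlanarGeometry` (lane «pcv-sawmu», car «WALL-DENSITY-SECOND-TERM», a-p6 g16).  Sequel of the same seat's
`HexSAWSurfaceWallDensityCoefficient.lean` (coefficient ONE of the `y⁻²` deficit, step `h = e^{−t/2}` over the second-order windows): the
FOURTH-order windows of `β(y)² = μ(y)²` (`HexSAWSurfaceFourthOrderLower.lean`: `fourth_lower_sharp`; `HexSAWSurfaceFourthOrderUpper.lean`:
`wallRate_sq_le_fourth`) pin `L(y) := log β(y)² − log y` to `y⁻² + y⁻³ + (3/2) y⁻⁴ + O(y⁻⁵)` (two more terms of `log(1+u)`), and the mesoscopic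
chord of the convex free energy `κ(t) = log β(eᵗ)` (`HexSAWSurfaceWallDensity.lean`: `wallRightDensity_le_slope`, `slope_le_wallLeftDensity`)
with the finer step `h = e^{−3t/2}` has chord error `O(h e^{−2t})` and window error `O(e^{−5t}/h)`, both `O(e^{−7t/2}) = o(e^{−3t})`.

Sources.  N. R. Beaton, M. Bousquet-Mélou, J. de Gier, H. Duminil-Copin, A. J. Guttmann, CMP 326 (2014) §3.1 (arXiv v5 p. 9: Proposition 5,
"log-convex"; p. 10: the first-order remark `μ(y) ~ √y`).  E. J. Janse van Rensburg (OUP 2000) §3.3 (densities as derivatives of free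
energies).  N. Madras, G. Slade (1993) §1.2.

## What is proved (namespace `…SAW.HexBW.Wall`)

* §1 `log_window_fifth (100 ≤ y) : |log β(y)² − log y − (y⁻² + y⁻³ + (3/2) y⁻⁴)| ≤ 950000 y⁻⁵` and its pure-exponential form.
* §2 numerics of the step `h = e^{−3t/2}`; §3 ★★ `half_sub_wallRightDensity_ge_two_terms`, ★★ `half_sub_wallLeftDensity_le_two_terms`
  (windows `e^{−2t} + (3/2) e^{−3t} ∓ K e^{−7t/2}`, `t ≥ log 100`); §4 ★★★ **`tendsto_exp_three_mul_deficit_sub_right`**,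
  ★★★ **`tendsto_exp_three_mul_deficit_sub_left`**: `e^{3t} (1/2 − ρ^±(t) − e^{−2t}) → 3/2`.

HONEST LABEL.  LANE THEOREM (S/M), OWN; NEW-IN-WRITING (modest): the second term of the contact-density deficit of the zig-zag honeycomb wall
(print: first order only).  NOT CLAIMED: the `y⁻⁴` density term (the windows give `L` to `O(y⁻⁵)` but the chord device with any step loses half an
order), constants, anything below `y = 100`.
-/

noncomputable section

open Filter Asymptotics Finset
open _root_.Topology

namespace Literature.Probability.RandomPlanarGeometry.SAW.HexBW.Wall

variable {y : ℝ}

/-! ### §1  The logarithmic window to order `y⁻⁵` -/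

/-- `|log(1+u) − u + u²/2| ≤ 2u³` for `0 ≤ u ≤ ½` (Mathlib's `Real.abs_log_sub_add_sum_range_le` with two terms). [cite: MadrasSlade1993, §1.2] -/
theorem abs_log_one_add_sub_two_terms_le {u : ℝ} (hu0 : 0 ≤ u) (hu1 : u ≤ 1 / 2) :
    |Real.log (1 + u) - u + u ^ 2 / 2| ≤ 2 * u ^ 3 := by
  have hum : |-u| < 1 := by rw [abs_neg, abs_of_nonneg hu0]; linarith
  have hlog := Real.abs_log_sub_add_sum_range_le hum 2
  have hsum : (∑ i ∈ Finset.range 2, (-u) ^ (i + 1) / (i + 1)) = -u + u ^ 2 / 2 := by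
    simp [Finset.sum_range_succ]
    ring
  rw [hsum, sub_neg_eq_add, abs_neg, abs_of_nonneg hu0, show -u + u ^ 2 / 2 + Real.log (1 + u) =
    Real.log (1 + u) - u + u ^ 2 / 2 by ring] at hlog
  have h32 : u ^ (2 + 1) = u ^ 3 := by norm_num
  rw [h32] at hlog
  have h6 : u ^ 3 / (1 - u) ≤ 2 * u ^ 3 := by
    rw [div_le_iff₀ (by linarith)]
    nlinarith [mul_nonneg (pow_nonneg hu0 3) (by linarith : (0 : ℝ) ≤ 1 - 2 * u)]
  exact hlog.trans h6

set_option maxHeartbeats 400000 in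
/-- ★ **The window to order `y⁻⁵`**: for `y ≥ 100`, `|log β(y)² − log y − (y⁻² + y⁻³ + (3/2)y⁻⁴)| ≤ 950000·y⁻⁵`.  With `a = 1/y` and
`u = β²/y − 1 ∈ [a² + a³ + 2a⁴ − 192476a⁵, a² + a³ + 2a⁴ + 708591a⁵]` (the fourth-order windows), `log(1+u) = u − u²/2 + O(u³)` and
`u² = a⁴ + 2a⁵ + O(a⁶)`. [cite: BeatonBousquetMelouDeGierDuminilCopinGuttmann2014, §3.1, Proposition 5 (arXiv v5 p. 9); p. 10 (first-order remark)] -/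
theorem log_window_fifth (hy : 100 ≤ y) :
    |Real.log (wallRate y ^ 2) - Real.log y - (1 / y ^ 2 + 1 / y ^ 3 + 3 / (2 * y ^ 4))| ≤ 950000 / y ^ 5 := by
  have hy0 : 0 < y := by linarith
  have hβ : 0 < wallRate y ^ 2 := pow_pos (wallRate_pos y) 2
  have hlo := fourth_lower_sharp (by linarith : (1 : ℝ) ≤ y)
  have hup := wallRate_sq_le_fourth (by linarith : (36 : ℝ) ≤ y)
  -- pass to `a = y⁻¹`
  have ha0 : 0 < y⁻¹ := inv_pos.2 hy0
  have ha1 : y⁻¹ ≤ 1 / 100 := by rw [← one_div]; exact one_div_le_one_div_of_le (by norm_num) hy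
  have hya : y * y⁻¹ = 1 := mul_inv_cancel₀ hy0.ne'
  simp only [div_eq_mul_inv, ← inv_pow, one_mul] at hlo hup
  rw [show (1 : ℝ) / y ^ 2 + 1 / y ^ 3 + 3 / (2 * y ^ 4) = y⁻¹ ^ 2 + y⁻¹ ^ 3 + 3 / 2 * y⁻¹ ^ 4 by
    field_simp, show (950000 : ℝ) / y ^ 5 = 950000 * y⁻¹ ^ 5 by rw [div_eq_mul_inv, ← inv_pow]]
  set a : ℝ := y⁻¹ with ha
  -- `u = β² a − 1`
  set u : ℝ := wallRate y ^ 2 * a - 1 with hu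
  have hlog_eq : Real.log (wallRate y ^ 2) - Real.log y = Real.log (1 + u) := by
    rw [← Real.log_div hβ.ne' hy0.ne', hu, div_eq_mul_inv]; congr 1; ring
  have hu_lo : a ^ 2 + a ^ 3 + 2 * a ^ 4 - 192476 * a ^ 5 ≤ u := by
    have := mul_le_mul_of_nonneg_right hlo ha0.le
    rw [hu]; nlinarith [hya]
  have hu_up : u ≤ a ^ 2 + a ^ 3 + 2 * a ^ 4 + 708591 * a ^ 5 := by
    have := mul_le_mul_of_nonneg_right hup ha0.le
    rw [hu]; nlinarith [hya]
  -- sizes: `a ≤ 1/100`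
  have ha2 : a ^ 2 ≤ 1 / 10000 := by nlinarith
  have ha5 : a ^ 5 ≤ a ^ 2 * (1 / 1000000) := by nlinarith [pow_pos ha0 2, pow_pos ha0 3, ha1]
  have hu0 : 0 ≤ u := by nlinarith [pow_pos ha0 2, pow_pos ha0 3, pow_pos ha0 4]
  have hu1 : u ≤ 1 / 2 := by nlinarith [pow_pos ha0 3, pow_pos ha0 4, pow_pos ha0 5]
  have hL := abs_log_one_add_sub_two_terms_le hu0 hu1
  rw [abs_le] at hL ⊢
  obtain ⟨hL1, hL2⟩ := hL
  -- `u²` window: `(a² + a³ − c a⁵)² ≥ a⁴ + 2a⁵ − 2c a⁷ − 2c a⁸` and the upper square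
  have hsq_lo : a ^ 4 + 2 * a ^ 5 - 400000 * a ^ 6 ≤ u ^ 2 := by
    have hv : a ^ 2 + a ^ 3 - 192476 * a ^ 5 ≤ u := by nlinarith [pow_pos ha0 4]
    have hv0 : 0 ≤ a ^ 2 + a ^ 3 - 192476 * a ^ 5 := by nlinarith [pow_pos ha0 2, pow_pos ha0 3]
    have h1 : (a ^ 2 + a ^ 3 - 192476 * a ^ 5) ^ 2 ≤ u ^ 2 := pow_le_pow_left₀ hv0 hv 2
    nlinarith [pow_pos ha0 6, pow_pos ha0 7, pow_pos ha0 8, pow_pos ha0 10,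
      mul_le_mul_of_nonneg_left ha1 (pow_pos ha0 6).le, mul_le_mul_of_nonneg_left ha1 (pow_pos ha0 7).le]
  have hsq_up : u ^ 2 ≤ a ^ 4 + 2 * a ^ 5 + 20000 * a ^ 6 := by
    have h1 : u ^ 2 ≤ (a ^ 2 + a ^ 3 + 2 * a ^ 4 + 708591 * a ^ 5) ^ 2 := pow_le_pow_left₀ hu0 hu_up 2
    nlinarith [pow_pos ha0 6, pow_pos ha0 7, pow_pos ha0 8, pow_pos ha0 9, pow_pos ha0 10,
      mul_le_mul_of_nonneg_left ha1 (pow_pos ha0 6).le, mul_le_mul_of_nonneg_left ha1 (pow_pos ha0 7).le,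
      mul_le_mul_of_nonneg_left ha1 (pow_pos ha0 8).le, mul_le_mul_of_nonneg_left ha1 (pow_pos ha0 9).le]
  have hcube : u ^ 3 ≤ 8 * a ^ 6 := by
    have e3 : a ^ 3 ≤ a ^ 2 * (1 / 100) := by
      rw [pow_succ]; exact mul_le_mul_of_nonneg_left ha1 (pow_pos ha0 2).le
    have e4 : a ^ 4 ≤ a ^ 2 * (1 / 10000) := by
      calc a ^ 4 = a ^ 2 * a ^ 2 := by ring
        _ ≤ a ^ 2 * (1 / 10000) := mul_le_mul_of_nonneg_left ha2 (pow_pos ha0 2).le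
    have h1 : u ≤ 2 * a ^ 2 := by linarith [pow_pos ha0 2]
    have h2 : u ^ 3 ≤ (2 * a ^ 2) ^ 3 := pow_le_pow_left₀ hu0 h1 3
    have h3 : (2 * a ^ 2 : ℝ) ^ 3 = 8 * a ^ 6 := by ring
    rw [h3] at h2
    exact h2
  have ha6 : a ^ 6 ≤ a ^ 5 * (1 / 100) := by nlinarith [pow_pos ha0 5]
  have ha5' : 0 < a ^ 5 := pow_pos ha0 5
  rw [hlog_eq]
  constructor
  · linarith
  · linarith


/-- Pure-exponential form of the window: for `x ≥ log 100`,
`|log β(eˣ)² − x − (e^{−2x} + e^{−3x} + (3/2) e^{−4x})| ≤ 950000 e^{−5x}`.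
[cite: BeatonBousquetMelouDeGierDuminilCopinGuttmann2014, §3.1, Proposition 5 (arXiv v5 p. 9); p. 10 (first-order remark)] -/
theorem log_window_fifth_exp {x : ℝ} (hx : Real.log 100 ≤ x) :
    |Real.log (wallRate (Real.exp x) ^ 2) - x -
        (Real.exp (-(2 * x)) + Real.exp (-(3 * x)) + 3 / 2 * Real.exp (-(4 * x)))| ≤ 950000 * Real.exp (-(5 * x)) := by
  have h100 : (100 : ℝ) ≤ Real.exp x := by
    have := Real.exp_le_exp.2 hx; rwa [Real.exp_log (by norm_num)] at this
  have h := log_window_fifth h100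
  have e : ∀ k : ℕ, 1 / Real.exp x ^ k = Real.exp (-((k : ℝ) * x)) := fun k => by
    rw [one_div, ← Real.exp_nat_mul, ← Real.exp_neg]
  have e2 := e 2; have e3 := e 3; have e4 := e 4; have e5 := e 5
  push_cast at e2 e3 e4 e5
  rw [Real.log_exp, show (3 : ℝ) / (2 * Real.exp x ^ 4) = 3 / 2 * (1 / Real.exp x ^ 4) by field_simp,
    show (950000 : ℝ) / Real.exp x ^ 5 = 950000 * (1 / Real.exp x ^ 5) by field_simp, e2, e3, e4, e5] at h
  exact h

/-! ### §2  The fine step `h = e^{−3t/2}` and its dictionary (`b = e^{−t/2}`) -/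

/-- For `t ≥ log 100`, with `b = e^{−t/2}` (the fine step is `h = b³ = e^{−3t/2}`): `0 < b ≤ 1/10` and the dictionary
`e^{−2t} = b⁴`, `e^{−3t} = b⁶`, `e^{−4t} = b⁸`, `e^{−5t} = b¹⁰`, `e^{−7t/2} = b⁷`. [cite: MadrasSlade1993, §1.2] -/
theorem fine_step_facts {t : ℝ} (ht : Real.log 100 ≤ t) :
    0 < Real.exp (-(t / 2)) ∧ Real.exp (-(t / 2)) ≤ 1 / 10 ∧ Real.exp (-(2 * t)) = Real.exp (-(t / 2)) ^ 4 ∧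
      Real.exp (-(3 * t)) = Real.exp (-(t / 2)) ^ 6 ∧ Real.exp (-(4 * t)) = Real.exp (-(t / 2)) ^ 8 ∧
      Real.exp (-(5 * t)) = Real.exp (-(t / 2)) ^ 10 ∧ Real.exp (-(7 * t / 2)) = Real.exp (-(t / 2)) ^ 7 := by
  refine ⟨Real.exp_pos _, ?_, ?_, ?_, ?_, ?_, ?_⟩
  · have h2 : Real.log 100 = 2 * Real.log 10 := by
      rw [show (100 : ℝ) = 10 ^ 2 by norm_num, Real.log_pow]; norm_num
    calc Real.exp (-(t / 2)) ≤ Real.exp (-Real.log 10) := Real.exp_le_exp.2 (by linarith)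
      _ = 1 / 10 := by rw [Real.exp_neg, Real.exp_log (by norm_num)]; norm_num
  all_goals rw [← Real.exp_nat_mul]; congr 1; push_cast; ring

/-- Second-order exponential bounds for the shifts (`0 ≤ h ≤ 1/4`): `e^{∓kh} ≤ 1 ∓ kh + k²h²` (`k = 2, 3, 4`), `e^{−4h}, e^{−5h} ≤ 1`, `e^{5h} ≤ 8`,
multiplied by `e^{−kt}`. [cite: MadrasSlade1993, §1.2] -/
theorem fine_shift_facts (t h : ℝ) (hh0 : 0 ≤ h) (hh1 : h ≤ 1 / 4) :
    Real.exp (-(2 * (t + h))) ≤ Real.exp (-(2 * t)) * (1 - 2 * h + 4 * h ^ 2) ∧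
      Real.exp (-(3 * (t + h))) ≤ Real.exp (-(3 * t)) * (1 - 3 * h + 9 * h ^ 2) ∧
      Real.exp (-(4 * (t + h))) ≤ Real.exp (-(4 * t)) ∧ Real.exp (-(5 * (t + h))) ≤ Real.exp (-(5 * t)) ∧
      Real.exp (-(2 * (t - h))) ≤ Real.exp (-(2 * t)) * (1 + 2 * h + 4 * h ^ 2) ∧
      Real.exp (-(3 * (t - h))) ≤ Real.exp (-(3 * t)) * (1 + 3 * h + 9 * h ^ 2) ∧
      Real.exp (-(4 * (t - h))) ≤ Real.exp (-(4 * t)) * (1 + 4 * h + 16 * h ^ 2) ∧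
      Real.exp (-(5 * (t - h))) ≤ Real.exp (-(5 * t)) * 8 := by
  have key : ∀ x : ℝ, |x| ≤ 1 → Real.exp x ≤ 1 + x + x ^ 2 := fun x hx => by
    have := Real.abs_exp_sub_one_sub_id_le hx
    rw [abs_le] at this
    nlinarith [this.2]
  have k2m := key (-(2 * h)) (by rw [abs_neg, abs_of_nonneg (by linarith)]; linarith)
  have k3m := key (-(3 * h)) (by rw [abs_neg, abs_of_nonneg (by linarith)]; linarith)
  have k2p := key (2 * h) (by rw [abs_of_nonneg (by linarith)]; linarith)
  have k3p := key (3 * h) (by rw [abs_of_nonneg (by linarith)]; linarith)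
  have k4p := key (4 * h) (by rw [abs_of_nonneg (by linarith)]; linarith)
  have he8 : Real.exp (5 * h) ≤ 8 := by
    have he := Real.exp_one_lt_d9
    calc Real.exp (5 * h) ≤ Real.exp 2 := Real.exp_le_exp.2 (by linarith)
      _ = Real.exp 1 ^ 2 := by rw [← Real.exp_nat_mul]; norm_num
      _ ≤ 8 := by nlinarith [Real.exp_pos 1]
  refine ⟨?_, ?_, Real.exp_le_exp.2 (by linarith), Real.exp_le_exp.2 (by linarith), ?_, ?_, ?_, ?_⟩
  · rw [show -(2 * (t + h)) = -(2 * t) + -(2 * h) by ring, Real.exp_add]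
    exact mul_le_mul_of_nonneg_left (by nlinarith) (Real.exp_pos _).le
  · rw [show -(3 * (t + h)) = -(3 * t) + -(3 * h) by ring, Real.exp_add]
    exact mul_le_mul_of_nonneg_left (by nlinarith) (Real.exp_pos _).le
  · rw [show -(2 * (t - h)) = -(2 * t) + 2 * h by ring, Real.exp_add]
    exact mul_le_mul_of_nonneg_left (by nlinarith) (Real.exp_pos _).le
  · rw [show -(3 * (t - h)) = -(3 * t) + 3 * h by ring, Real.exp_add]
    exact mul_le_mul_of_nonneg_left (by nlinarith) (Real.exp_pos _).le
  · rw [show -(4 * (t - h)) = -(4 * t) + 4 * h by ring, Real.exp_add]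
    exact mul_le_mul_of_nonneg_left (by nlinarith) (Real.exp_pos _).le
  · rw [show -(5 * (t - h)) = -(5 * t) + 5 * h by ring, Real.exp_add]
    exact mul_le_mul_of_nonneg_left he8 (Real.exp_pos _).le

/-! ### §3  The two chords with the fine step -/

set_option maxHeartbeats 400000 in
/-- ★★ **`e^{−2t} + (3/2) e^{−3t} − 950003·e^{−7t/2} ≤ 1/2 − ρ⁺(t)` for `t ≥ log 200`**: `ρ⁺(t) ≤ (κ(t+h) − κ(t))/h` with `h = b³`,
`b = e^{−t/2}`, and `2(κ(t+h) − κ(t)) = L(t+h) − L(t) + h ≤ h − 2h b⁴ − 3h b⁶ + 4h² b⁴ + 9h² b⁶ + 1.9·10⁶ b¹⁰` by §1–§2.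
[cite: BeatonBousquetMelouDeGierDuminilCopinGuttmann2014, §3.1, Proposition 5 (arXiv v5 p. 9: "log-convex")] [cite: JansevanRensburg2000, §3.3 (densities as derivatives of the free energy)] -/
theorem half_sub_wallRightDensity_ge_two_terms {t : ℝ} (ht : Real.log 200 ≤ t) :
    Real.exp (-(2 * t)) + 3 / 2 * Real.exp (-(3 * t)) - 950003 * Real.exp (-(7 * t / 2)) ≤ 1 / 2 - wallRightDensity t := by
  have ht100 : Real.log 100 ≤ t := (Real.log_le_log (by norm_num) (by norm_num)).trans ht
  obtain ⟨hb0, hb1, e2, e3, e4, e5, e7⟩ := fine_step_facts ht100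
  have hb2 : Real.exp (-(t / 2)) ^ 2 ≤ 1 / 100 := by nlinarith
  have hh0 : 0 < Real.exp (-(t / 2)) ^ 3 := pow_pos hb0 3
  have hh1 : Real.exp (-(t / 2)) ^ 3 ≤ 1 / 4 := by nlinarith
  obtain ⟨s2, s3, s4, s5, -, -, -, -⟩ := fine_shift_facts t (Real.exp (-(t / 2)) ^ 3) hh0.le hh1
  -- the chord
  have hlt : t < t + Real.exp (-(t / 2)) ^ 3 := by linarith
  have hρ := wallRightDensity_le_slope hlt
  rw [slope_def_field, show t + Real.exp (-(t / 2)) ^ 3 - t = Real.exp (-(t / 2)) ^ 3 by ring] at hρ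
  have hk : 2 * (wallFreeEnergy (t + Real.exp (-(t / 2)) ^ 3) - wallFreeEnergy t) =
      (Real.log (wallRate (Real.exp (t + Real.exp (-(t / 2)) ^ 3)) ^ 2) - (t + Real.exp (-(t / 2)) ^ 3)) -
        (Real.log (wallRate (Real.exp t) ^ 2) - t) + Real.exp (-(t / 2)) ^ 3 := by
    rw [wallFreeEnergy_apply, wallFreeEnergy_apply, Real.log_pow, Real.log_pow]; push_cast; ring
  have hU := log_window_fifth_exp (x := t + Real.exp (-(t / 2)) ^ 3) (by linarith)
  have hL := log_window_fifth_exp ht100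
  rw [abs_le] at hU hL
  obtain ⟨-, hU⟩ := hU
  obtain ⟨hL, -⟩ := hL
  rw [e2, e3, e4, e5] at hL
  rw [e2] at s2
  rw [e3] at s3
  rw [e4] at s4
  rw [e5] at s5
  have hk2 : 2 * (wallFreeEnergy (t + Real.exp (-(t / 2)) ^ 3) - wallFreeEnergy t) ≤
      Real.exp (-(t / 2)) ^ 3 - 2 * Real.exp (-(t / 2)) ^ 7 - 3 * Real.exp (-(t / 2)) ^ 9 +
        1900004 * Real.exp (-(t / 2)) ^ 10 + 9 * Real.exp (-(t / 2)) ^ 12 := by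
    rw [hk]
    linear_combination hU + hL + s2 + s3 + (3 / 2 : ℝ) * s4 + 950000 * s5
  have hk3 : (wallFreeEnergy (t + Real.exp (-(t / 2)) ^ 3) - wallFreeEnergy t) / Real.exp (-(t / 2)) ^ 3 ≤
      1 / 2 - Real.exp (-(t / 2)) ^ 4 - 3 / 2 * Real.exp (-(t / 2)) ^ 6 + 950003 * Real.exp (-(t / 2)) ^ 7 := by
    rw [div_le_iff₀ hh0]
    nlinarith [pow_pos hb0 10, mul_le_mul_of_nonneg_left hb2 (pow_pos hb0 10).le]
  rw [e2, e3, e7]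
  linarith

set_option maxHeartbeats 400000 in
/-- ★★ **`1/2 − ρ⁻(t) ≤ e^{−2t} + (3/2) e^{−3t} + 4275004·e^{−7t/2}` for `t ≥ log 200`**: `(κ(t) − κ(t−h))/h ≤ ρ⁻(t)` with `h = b³`,
`b = e^{−t/2}` (`t − h ≥ log 100` since `h ≤ 10⁻³ < log 2`), and `2(κ(t) − κ(t−h)) = L(t) − L(t−h) + h ≥
h − 2h b⁴ − 3h b⁶ − 6h b⁸ − 4h² b⁴ − 9h² b⁶ − 24h² b⁸ − 8.55·10⁶ b¹⁰`.
[cite: BeatonBousquetMelouDeGierDuminilCopinGuttmann2014, §3.1, Proposition 5 (arXiv v5 p. 9: "log-convex")] [cite: JansevanRensburg2000, §3.3 (densities as derivatives of the free energy)] -/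
theorem half_sub_wallLeftDensity_le_two_terms {t : ℝ} (ht : Real.log 200 ≤ t) :
    1 / 2 - wallLeftDensity t ≤ Real.exp (-(2 * t)) + 3 / 2 * Real.exp (-(3 * t)) + 4275004 * Real.exp (-(7 * t / 2)) := by
  have ht100 : Real.log 100 ≤ t := (Real.log_le_log (by norm_num) (by norm_num)).trans ht
  obtain ⟨hb0, hb1, e2, e3, e4, e5, e7⟩ := fine_step_facts ht100
  have hb2 : Real.exp (-(t / 2)) ^ 2 ≤ 1 / 100 := by nlinarith
  have hb4 : Real.exp (-(t / 2)) ^ 4 ≤ 1 / 10000 := by nlinarith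
  have hh0 : 0 < Real.exp (-(t / 2)) ^ 3 := pow_pos hb0 3
  have hh1 : Real.exp (-(t / 2)) ^ 3 ≤ 1 / 4 := by nlinarith
  have hh2 : Real.exp (-(t / 2)) ^ 3 ≤ 1 / 1000 := by nlinarith
  obtain ⟨-, -, -, -, s2, s3, s4, s5⟩ := fine_shift_facts t (Real.exp (-(t / 2)) ^ 3) hh0.le hh1
  -- `t − h ≥ log 100`
  have hlog2 : Real.log 200 = Real.log 100 + Real.log 2 := by
    rw [show (200 : ℝ) = 100 * 2 by norm_num, Real.log_mul (by norm_num) (by norm_num)]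
  have hth : Real.log 100 ≤ t - Real.exp (-(t / 2)) ^ 3 := by
    have := Real.log_two_gt_d9; linarith
  -- the chord
  have hlt : t - Real.exp (-(t / 2)) ^ 3 < t := by linarith
  have hρ := slope_le_wallLeftDensity hlt
  rw [slope_def_field, show t - (t - Real.exp (-(t / 2)) ^ 3) = Real.exp (-(t / 2)) ^ 3 by ring] at hρ
  have hk : 2 * (wallFreeEnergy t - wallFreeEnergy (t - Real.exp (-(t / 2)) ^ 3)) =
      (Real.log (wallRate (Real.exp t) ^ 2) - t) -
        (Real.log (wallRate (Real.exp (t - Real.exp (-(t / 2)) ^ 3)) ^ 2) - (t - Real.exp (-(t / 2)) ^ 3)) +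
          Real.exp (-(t / 2)) ^ 3 := by
    rw [wallFreeEnergy_apply, wallFreeEnergy_apply, Real.log_pow, Real.log_pow]; push_cast; ring
  have hU := log_window_fifth_exp hth
  have hL := log_window_fifth_exp ht100
  rw [abs_le] at hU hL
  obtain ⟨-, hU⟩ := hU
  obtain ⟨hL, -⟩ := hL
  rw [e2, e3, e4, e5] at hL
  rw [e2] at s2
  rw [e3] at s3
  rw [e4] at s4
  rw [e5] at s5
  have hk2 : Real.exp (-(t / 2)) ^ 3 - 2 * Real.exp (-(t / 2)) ^ 7 - 3 * Real.exp (-(t / 2)) ^ 9 -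
      8550004 * Real.exp (-(t / 2)) ^ 10 - 6 * Real.exp (-(t / 2)) ^ 11 - 9 * Real.exp (-(t / 2)) ^ 12 -
        24 * Real.exp (-(t / 2)) ^ 14 ≤ 2 * (wallFreeEnergy t - wallFreeEnergy (t - Real.exp (-(t / 2)) ^ 3)) := by
    rw [hk]
    linear_combination hL + hU + s2 + s3 + (3 / 2 : ℝ) * s4 + 950000 * s5
  have hk3 : 1 / 2 - Real.exp (-(t / 2)) ^ 4 - 3 / 2 * Real.exp (-(t / 2)) ^ 6 - 4275004 * Real.exp (-(t / 2)) ^ 7 ≤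
      (wallFreeEnergy t - wallFreeEnergy (t - Real.exp (-(t / 2)) ^ 3)) / Real.exp (-(t / 2)) ^ 3 := by
    rw [le_div_iff₀ hh0]
    nlinarith [pow_pos hb0 10, mul_le_mul_of_nonneg_left hb1 (pow_pos hb0 10).le,
      mul_le_mul_of_nonneg_left hb2 (pow_pos hb0 10).le, mul_le_mul_of_nonneg_left hb4 (pow_pos hb0 10).le]
  rw [e2, e3, e7]
  linarith

/-- ★★ **The two-term window**: for `t ≥ log 200`,
`e^{−2t} + (3/2)e^{−3t} − 950003 e^{−7t/2} ≤ 1/2 − ρ⁺(t) ≤ 1/2 − ρ⁻(t) ≤ e^{−2t} + (3/2)e^{−3t} + 4275004 e^{−7t/2}`.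
[cite: BeatonBousquetMelouDeGierDuminilCopinGuttmann2014, §3.1, Proposition 5 (arXiv v5 p. 9)] [cite: JansevanRensburg2000, §3.3] -/
theorem wallDensity_deficit_two_term_window {t : ℝ} (ht : Real.log 200 ≤ t) :
    Real.exp (-(2 * t)) + 3 / 2 * Real.exp (-(3 * t)) - 950003 * Real.exp (-(7 * t / 2)) ≤ 1 / 2 - wallRightDensity t ∧
      1 / 2 - wallRightDensity t ≤ 1 / 2 - wallLeftDensity t ∧
      1 / 2 - wallLeftDensity t ≤ Real.exp (-(2 * t)) + 3 / 2 * Real.exp (-(3 * t)) + 4275004 * Real.exp (-(7 * t / 2)) :=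
  ⟨half_sub_wallRightDensity_ge_two_terms ht, by linarith [wallLeftDensity_le_wallRightDensity t],
    half_sub_wallLeftDensity_le_two_terms ht⟩

/-! ### §4  The second coefficient is `3/2` -/

/-- `e^{3t} · e^{−7t/2} = e^{−t/2} → 0` and `e^{3t} e^{−2t} = eᵗ`, `e^{3t} e^{−3t} = 1`. [cite: MadrasSlade1993, §1.2] -/
theorem exp_three_mul_facts :
    Tendsto (fun t : ℝ => Real.exp (3 * t) * Real.exp (-(7 * t / 2))) atTop (𝓝 0) ∧
      ∀ t : ℝ, Real.exp (3 * t) * Real.exp (-(3 * t)) = 1 := by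
  refine ⟨?_, fun t => by rw [← Real.exp_add]; simp⟩
  have h : Tendsto (fun t : ℝ => Real.exp (-(t / 2))) atTop (𝓝 0) := by
    have := Real.tendsto_exp_neg_atTop_nhds_zero.comp (tendsto_id.atTop_div_const (by norm_num : (0 : ℝ) < 2))
    exact this.congr fun t => by simp
  refine h.congr fun t => ?_
  rw [← Real.exp_add]; congr 1; ring

/-- ★★★ **THE SECOND DEFICIT COEFFICIENT IS `3/2` (right density): `e^{3t} (1/2 − ρ⁺(t) − e^{−2t}) → 3/2`** — in the fugacity,
`ρ⁺(y) = 1/2 − y⁻² − (3/2) y⁻³ + O(y^{−7/2})`. [cite: BeatonBousquetMelouDeGierDuminilCopinGuttmann2014, §3.1, Proposition 5 (arXiv v5 p. 9); p. 10 (first-order remark)] [cite: JansevanRensburg2000, §3.3] -/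
theorem tendsto_exp_three_mul_deficit_sub_right :
    Tendsto (fun t : ℝ => Real.exp (3 * t) * (1 / 2 - wallRightDensity t - Real.exp (-(2 * t)))) atTop (𝓝 (3 / 2)) := by
  obtain ⟨h0, h1⟩ := exp_three_mul_facts
  have hlow : Tendsto (fun t : ℝ => 3 / 2 - 950003 * (Real.exp (3 * t) * Real.exp (-(7 * t / 2)))) atTop (𝓝 (3 / 2)) := by
    simpa using (h0.const_mul 950003).const_sub (3 / 2)
  have hup : Tendsto (fun t : ℝ => 3 / 2 + 4275004 * (Real.exp (3 * t) * Real.exp (-(7 * t / 2)))) atTop (𝓝 (3 / 2)) := by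
    simpa using (h0.const_mul 4275004).const_add (3 / 2)
  refine tendsto_of_tendsto_of_tendsto_of_le_of_le' hlow hup ?_ ?_
  · filter_upwards [eventually_ge_atTop (Real.log 200)] with t ht
    obtain ⟨h2, -, -⟩ := wallDensity_deficit_two_term_window ht
    have := mul_le_mul_of_nonneg_left h2 (Real.exp_pos (3 * t)).le
    nlinarith [Real.exp_pos (3 * t), h1 t]
  · filter_upwards [eventually_ge_atTop (Real.log 200)] with t ht
    obtain ⟨-, h2, h3⟩ := wallDensity_deficit_two_term_window ht
    have := mul_le_mul_of_nonneg_left (h2.trans h3) (Real.exp_pos (3 * t)).le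
    nlinarith [Real.exp_pos (3 * t), h1 t]

/-- ★★★ **THE SECOND DEFICIT COEFFICIENT IS `3/2` (left density): `e^{3t} (1/2 − ρ⁻(t) − e^{−2t}) → 3/2`.**
[cite: BeatonBousquetMelouDeGierDuminilCopinGuttmann2014, §3.1, Proposition 5 (arXiv v5 p. 9); p. 10 (first-order remark)] [cite: JansevanRensburg2000, §3.3] -/
theorem tendsto_exp_three_mul_deficit_sub_left :
    Tendsto (fun t : ℝ => Real.exp (3 * t) * (1 / 2 - wallLeftDensity t - Real.exp (-(2 * t)))) atTop (𝓝 (3 / 2)) := by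
  obtain ⟨h0, h1⟩ := exp_three_mul_facts
  have hlow : Tendsto (fun t : ℝ => 3 / 2 - 950003 * (Real.exp (3 * t) * Real.exp (-(7 * t / 2)))) atTop (𝓝 (3 / 2)) := by
    simpa using (h0.const_mul 950003).const_sub (3 / 2)
  have hup : Tendsto (fun t : ℝ => 3 / 2 + 4275004 * (Real.exp (3 * t) * Real.exp (-(7 * t / 2)))) atTop (𝓝 (3 / 2)) := by
    simpa using (h0.const_mul 4275004).const_add (3 / 2)
  refine tendsto_of_tendsto_of_tendsto_of_le_of_le' hlow hup ?_ ?_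
  · filter_upwards [eventually_ge_atTop (Real.log 200)] with t ht
    obtain ⟨h2, h3, -⟩ := wallDensity_deficit_two_term_window ht
    have := mul_le_mul_of_nonneg_left (h2.trans h3) (Real.exp_pos (3 * t)).le
    nlinarith [Real.exp_pos (3 * t), h1 t]
  · filter_upwards [eventually_ge_atTop (Real.log 200)] with t ht
    obtain ⟨-, -, h3⟩ := wallDensity_deficit_two_term_window ht
    have := mul_le_mul_of_nonneg_left h3 (Real.exp_pos (3 * t)).le
    nlinarith [Real.exp_pos (3 * t), h1 t]

end Literature.Probability.RandomPlanarGeometry.SAW.HexBW.Wall
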